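import Summits.AnomalousDissipation.AnomalousDissipation.Theorems.SolenoidalFractalHomogenisationLagrangianStepCellLawVOddGainDefectDuhamel
import Summits.AnomalousDissipation.AnomalousDissipation.Theorems.SolenoidalFractalHomogenisationLagrangianStepCellLawVOddGainDefectLowerEdge
import Mathlib.Analysis.SpecialFunctions.Integrals.Basic
import HarnessLib

/-!
# W5 odd half — §8: a PROVED lossy substitute for the sector-preservation hypothesis L1⁺ (K1L_D helper)

§8 of planner ad-ideate-p5 g8's `Cruxes/LagrangianRenormalisationStep/OddGainDefectSectorialWindow.lean` v5 (sha ae96de68…; tenure D24-16/17: design (A)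
«ΛV ∈ [1.02, 1.03], M ≥ 0.02, τ₀ ≤ 0.05 ⇒ κ ≤ 0.95 with NO analytic hypothesis» rests on it): **a PROVED, LOSSY SUBSTITUTE for the
sector-preservation hypothesis L1⁺** — `f_T(B)` is `τ·θ`-sectorial with `θ = hi·g_T(lo)/(f_T(hi) − (τhi/2)g_T(lo))`:
`sum_sum_mul_qsResp_coeff(_le)`, `skewForm_exp_le`, `skewForm_qsResp_le`, **`qsResp_sector_lossy`**, `def LossySectorTarget` + **`lossySectorTarget_holds`**.
Uses the worker's `lowerEdgeTarget_holds` (`…OddGainDefectLowerEdge`) by name and the Duhamel file. Bodies byte-identical (modulo the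
`form_symPart_quad` rename). No named facts, no sorry. Lander: prover ad-k3l-bookkeeping-p1 g4.
-/

set_option linter.dupNamespace false
set_option linter.style.longLine false

noncomputable section

namespace Summit.AnomalousDissipation.AnomalousDissipation.Theorems.SolenoidalFractalHomogenisation.LagrangianStep.OddGain

open Matrix Finset
open Literature.Analysis.FluidPDE.KY (real_dot_eq)

section LossySector

open Literature.Analysis Literature.Analysis.FunctionSpaces Literature.Analysis.FluidPDE
open Literature.Analysis.FluidPDE.LatticeShear
open Literature.Analysis.ODE.PeriodicAveraging

/-- Finite double sums with constant coefficients commute with the interval integral (copy of the private helper of p643071). [folklore] -/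
theorem integral_sum_sum_mul' {f : Fin 3 → Fin 3 → ℝ → ℝ} {a b : ℝ} (c : Fin 3 → Fin 3 → ℝ)
    (hf : ∀ i j, IntervalIntegrable (f i j) MeasureTheory.volume a b) :
    ∫ x in a..b, ∑ i, ∑ j, c i j * f i j x = ∑ i, ∑ j, c i j * ∫ x in a..b, f i j x := by
  rw [intervalIntegral.integral_finsetSum]
  · refine Finset.sum_congr rfl fun i _ => ?_
    rw [intervalIntegral.integral_finsetSum]
    · exact Finset.sum_congr rfl fun j _ => intervalIntegral.integral_const_mul _ _
    · exact fun j _ => (hf i j).const_mul _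
  · intro i _
    have h := IntervalIntegrable.sum Finset.univ fun j (_ : j ∈ Finset.univ) => (hf i j).const_mul (c i j)
    rw [Finset.sum_fn] at h
    exact h

/-- **A linear functional of `qsResp` is the double integral of the functional of the kernel** (general coefficients `c i j`;
`sum_sum_mul_qsResp_mul` is the rank-one case `c i j = v i * w j`). [folklore] -/
theorem sum_sum_mul_qsResp_coeff (ρ T : ℝ) (B : Matrix (Fin 3) (Fin 3) ℝ) (c : Fin 3 → Fin 3 → ℝ) :
    ∑ i, ∑ j, c i j * qsResp ρ T B i j =
      T * ∫ s in (0:ℝ)..1, LatticeShear.LatticeWord.trapezoid 0 1 ρ s *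
        ∫ x in (0:ℝ)..s, LatticeShear.LatticeWord.trapezoid 0 1 ρ x *
          ∑ i, ∑ j, c i j * (NormedSpace.exp (-(T * (s - x)) • B)) i j := by
  set α : ℝ → ℝ := fun s => LatticeShear.LatticeWord.trapezoid 0 1 ρ s with hα
  set E : ℝ → ℝ → Fin 3 → Fin 3 → ℝ := fun s x i j => (NormedSpace.exp (-(T * (s - x)) • B)) i j with hE
  have hin : ∀ i j s, IntervalIntegrable (fun x => α x * E s x i j) MeasureTheory.volume 0 s := fun i j s =>
    ((continuous_trapezoid_unit ρ).mul
      ((continuous_qsKernel_apply T B i j).comp (continuous_const.prodMk continuous_id))).intervalIntegrable _ _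
  have hout : ∀ i j, IntervalIntegrable (fun s => α s * ∫ x in (0:ℝ)..s, α x * E s x i j) MeasureTheory.volume 0 1 := by
    intro i j
    have hf : Continuous (Function.uncurry fun s x : ℝ => α x * E s x i j) :=
      ((continuous_trapezoid_unit ρ).comp continuous_snd).mul (continuous_qsKernel_apply T B i j)
    exact ((continuous_trapezoid_unit ρ).mul
      (intervalIntegral.continuous_parametric_intervalIntegral_of_continuous (a₀ := 0) hf
        continuous_id)).intervalIntegrable _ _
  have hinner : ∀ s, ∫ x in (0:ℝ)..s, α x * ∑ i, ∑ j, c i j * E s x i j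
      = ∑ i, ∑ j, c i j * ∫ x in (0:ℝ)..s, α x * E s x i j := by
    intro s
    rw [← integral_sum_sum_mul' c fun i j => hin i j s]
    refine intervalIntegral.integral_congr fun x _ => ?_
    show α x * ∑ i, ∑ j, c i j * E s x i j = ∑ i, ∑ j, c i j * (α x * E s x i j)
    rw [Finset.mul_sum]
    refine Finset.sum_congr rfl fun i _ => ?_
    rw [Finset.mul_sum]
    refine Finset.sum_congr rfl fun j _ => ?_
    ring
  have houter : ∫ s in (0:ℝ)..1, α s * ∫ x in (0:ℝ)..s, α x * ∑ i, ∑ j, c i j * E s x i j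
      = ∑ i, ∑ j, c i j * ∫ s in (0:ℝ)..1, α s * ∫ x in (0:ℝ)..s, α x * E s x i j := by
    rw [← integral_sum_sum_mul' c hout]
    refine intervalIntegral.integral_congr fun s _ => ?_
    show α s * (∫ x in (0:ℝ)..s, α x * ∑ i, ∑ j, c i j * E s x i j)
      = ∑ i, ∑ j, c i j * (α s * ∫ x in (0:ℝ)..s, α x * E s x i j)
    rw [hinner s, Finset.mul_sum]
    refine Finset.sum_congr rfl fun i _ => ?_
    rw [Finset.mul_sum]
    refine Finset.sum_congr rfl fun j _ => ?_
    ring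
  simp only [qsResp]
  rw [houter, Finset.mul_sum]
  refine Finset.sum_congr rfl fun i _ => ?_
  rw [Finset.mul_sum]
  refine Finset.sum_congr rfl fun j _ => ?_
  ring

/-- Continuity of a linear functional of the kernel. -/
theorem continuous_qsKernel_coeff (T : ℝ) (B : Matrix (Fin 3) (Fin 3) ℝ) (c : Fin 3 → Fin 3 → ℝ) :
    Continuous fun p : ℝ × ℝ => ∑ i, ∑ j, c i j * (NormedSpace.exp (-(T * (p.1 - p.2)) • B)) i j :=
  continuous_finsetSum _ fun i _ => continuous_finsetSum _ fun j _ =>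
    continuous_const.mul (continuous_qsKernel_apply T B i j)

/-- **Monotone kernel integration for a linear functional**: `Σ c_ij e^{−uB}_ij ≤ g(u)` for `u ≥ 0` (`g` continuous) gives
`Σ c_ij f_T(B)_ij ≤ T∫∫ a a g(T(s−x))` (`T ≥ 0`, weights `a ≥ 0`). [folklore] -/
theorem sum_sum_mul_qsResp_coeff_le {ρ T : ℝ} (hT : 0 ≤ T) {B : Matrix (Fin 3) (Fin 3) ℝ} (c : Fin 3 → Fin 3 → ℝ)
    {g : ℝ → ℝ} (hg : Continuous g)
    (hle : ∀ u : ℝ, 0 ≤ u → ∑ i, ∑ j, c i j * (NormedSpace.exp (-(u • B))) i j ≤ g u) :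
    ∑ i, ∑ j, c i j * qsResp ρ T B i j ≤
      T * ∫ s in (0:ℝ)..1, LatticeShear.LatticeWord.trapezoid 0 1 ρ s *
        ∫ x in (0:ℝ)..s, LatticeShear.LatticeWord.trapezoid 0 1 ρ x * g (T * (s - x)) := by
  rw [sum_sum_mul_qsResp_coeff]
  refine mul_le_mul_of_nonneg_left ?_ hT
  have hsc : Continuous fun p : ℝ × ℝ => g (T * (p.1 - p.2)) := hg.comp (by fun_prop)
  refine intervalIntegral.integral_mono_on zero_le_one ?_ ?_ fun s hs => ?_
  · have hf : Continuous (Function.uncurry fun s x : ℝ => LatticeShear.LatticeWord.trapezoid 0 1 ρ x *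
        ∑ i, ∑ j, c i j * (NormedSpace.exp (-(T * (s - x)) • B)) i j) :=
      ((continuous_trapezoid_unit ρ).comp continuous_snd).mul (continuous_qsKernel_coeff T B c)
    exact ((continuous_trapezoid_unit ρ).mul
      (intervalIntegral.continuous_parametric_intervalIntegral_of_continuous (a₀ := 0) hf
        continuous_id)).intervalIntegrable _ _
  · have hf : Continuous (Function.uncurry fun s x : ℝ => LatticeShear.LatticeWord.trapezoid 0 1 ρ x *
        g (T * (s - x))) :=
      ((continuous_trapezoid_unit ρ).comp continuous_snd).mul hsc
    exact ((continuous_trapezoid_unit ρ).mul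
      (intervalIntegral.continuous_parametric_intervalIntegral_of_continuous (a₀ := 0) hf
        continuous_id)).intervalIntegrable _ _
  · refine mul_le_mul_of_nonneg_left ?_ (trapezoid_unit_nonneg ρ s)
    refine intervalIntegral.integral_mono_on hs.1 ?_ ?_ fun x hx => ?_
    · exact ((continuous_trapezoid_unit ρ).mul
        ((continuous_qsKernel_coeff T B c).comp (continuous_const.prodMk continuous_id))).intervalIntegrable _ _
    · exact ((continuous_trapezoid_unit ρ).mul
        (hsc.comp (continuous_const.prodMk continuous_id))).intervalIntegrable _ _
    · refine mul_le_mul_of_nonneg_left ?_ (trapezoid_unit_nonneg ρ x)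
      have hu : 0 ≤ T * (s - x) := mul_nonneg hT (by linarith [hx.2])
      have h := hle (T * (s - x)) hu
      rw [neg_smul]
      exact h

/-- The skew form `xᵀMz − zᵀMx` as a linear functional of `M` with coefficients `xᵢzⱼ − zᵢxⱼ`. -/
theorem skewForm_eq_sum_sum (M : Matrix (Fin 3) (Fin 3) ℝ) (x z : Fin 3 → ℝ) :
    x ⬝ᵥ M *ᵥ z - z ⬝ᵥ M *ᵥ x = ∑ i, ∑ j, (x i * z j - z i * x j) * M i j := by
  rw [← sum_sum_eq_form, ← sum_sum_eq_form, ← Finset.sum_sub_distrib]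
  refine Finset.sum_congr rfl fun i _ => ?_
  rw [← Finset.sum_sub_distrib]
  refine Finset.sum_congr rfl fun j _ => ?_
  ring

/-- The moment kernel with a constant: `T∫∫ a a (k · T(s−x) e^{−T(s−x)lo}) = k · g_T(lo)`. -/
theorem kernel_moment_const_eq (ρ T lo k : ℝ) :
    T * ∫ s in (0:ℝ)..1, LatticeShear.LatticeWord.trapezoid 0 1 ρ s *
      ∫ x in (0:ℝ)..s, LatticeShear.LatticeWord.trapezoid 0 1 ρ x * (k * ((T * (s - x)) * Real.exp (-(T * (s - x)) * lo))) =
      k * qsRespMoment ρ T lo := by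
  unfold qsRespMoment
  have hinner : ∀ s, ∫ x in (0:ℝ)..s, LatticeShear.LatticeWord.trapezoid 0 1 ρ x *
      (k * ((T * (s - x)) * Real.exp (-(T * (s - x)) * lo))) =
      k * ∫ x in (0:ℝ)..s, LatticeShear.LatticeWord.trapezoid 0 1 ρ x * ((T * (s - x)) * Real.exp (-(T * (s - x)) * lo)) := by
    intro s
    rw [← intervalIntegral.integral_const_mul]
    refine intervalIntegral.integral_congr fun x _ => ?_
    ring
  simp_rw [hinner]
  have houter : ∫ s in (0:ℝ)..1, LatticeShear.LatticeWord.trapezoid 0 1 ρ s *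
      (k * ∫ x in (0:ℝ)..s, LatticeShear.LatticeWord.trapezoid 0 1 ρ x * ((T * (s - x)) * Real.exp (-(T * (s - x)) * lo))) =
      k * ∫ s in (0:ℝ)..1, LatticeShear.LatticeWord.trapezoid 0 1 ρ s *
        ∫ x in (0:ℝ)..s, LatticeShear.LatticeWord.trapezoid 0 1 ρ x * ((T * (s - x)) * Real.exp (-(T * (s - x)) * lo)) := by
    rw [← intervalIntegral.integral_const_mul]
    refine intervalIntegral.integral_congr fun s _ => ?_
    ring
  rw [houter]; ring

/-- **Pointwise skew bound for the semigroup of a sectorial block**: for `u ≥ 0`,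
`xᵀe^{−uB}z − zᵀe^{−uB}x ≤ τ·hi·u·e^{−lo u}·(|x|² + |z|²)/2`  (the symmetric semigroup `e^{−uH}` has no skew part; the Duhamel
defect has operator norm `≤ (τhi/2)u e^{−lo u}` by `duhamel_defect_sq_le_one`; AM–GM on `|x||z|`). [folklore] -/
theorem skewForm_exp_le {B : Matrix (Fin 3) (Fin 3) ℝ} {τ lo hi : ℝ} (hτ : 0 ≤ τ) (hlo : 0 < lo)
    (hsec : ∀ x z : Fin 3 → ℝ, (x ⬝ᵥ B *ᵥ z - z ⬝ᵥ B *ᵥ x) ^ 2 ≤ τ ^ 2 * ((x ⬝ᵥ B *ᵥ x) * (z ⬝ᵥ B *ᵥ z)))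
    (hwin : ∀ x : Fin 3 → ℝ, lo * (x ⬝ᵥ x) ≤ x ⬝ᵥ B *ᵥ x ∧ x ⬝ᵥ B *ᵥ x ≤ hi * (x ⬝ᵥ x)) (x z : Fin 3 → ℝ) {u : ℝ} (hu : 0 ≤ u) :
    x ⬝ᵥ (NormedSpace.exp (-(u • B))) *ᵥ z - z ⬝ᵥ (NormedSpace.exp (-(u • B))) *ᵥ x ≤
      τ * hi * u * Real.exp (-(lo * u)) * ((x ⬝ᵥ x + z ⬝ᵥ z) / 2) := by
  set E := NormedSpace.exp (-(u • B)) with hEdef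
  set EH := NormedSpace.exp (-(u • symPart B)) with hEH
  have hhi : 0 ≤ hi := hlo.le.trans (lo_le_hi_of_window hwin)
  have hEHsymm : EH.IsSymm := by
    rw [hEH]
    exact (Matrix.IsSymm.smul (symPart_isSymm B) u).neg.exp
  -- the symmetric semigroup has no skew part
  have hsym0 : x ⬝ᵥ EH *ᵥ z = z ⬝ᵥ EH *ᵥ x := by
    rw [form_comm_transpose EH z x]
    unfold Matrix.IsSymm at hEHsymm
    rw [hEHsymm]
  -- the defect bound, for z and for x
  set C := τ * hi / 2 * u * Real.exp (-(lo * u)) with hC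
  have hC0 : 0 ≤ C := by rw [hC]; positivity
  have hdef : ∀ v : Fin 3 → ℝ, ∑ i, (E *ᵥ v - EH *ᵥ v) i ^ 2 ≤ C ^ 2 * ∑ i, v i ^ 2 := by
    intro v
    have h := duhamel_defect_sq_le_one hτ hlo.le hhi hsec hwin v hu
    have he2 : Real.exp (-(lo * u)) ^ 2 = Real.exp (-(2 * lo * u)) := by
      rw [sq, ← Real.exp_add]; congr 1; ring
    calc ∑ i, (E *ᵥ v - EH *ᵥ v) i ^ 2 ≤ (τ * hi / 2) ^ 2 * u ^ 2 * Real.exp (-(2 * lo * u)) * ∑ i, v i ^ 2 := h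
      _ = C ^ 2 * ∑ i, v i ^ 2 := by rw [hC, mul_pow, mul_pow, he2]
  -- Cauchy–Schwarz: |x ⬝ (E z − EH z)| ≤ C |x||z|, squared form
  have hcs : ∀ p q : Fin 3 → ℝ, (p ⬝ᵥ (E *ᵥ q - EH *ᵥ q)) ^ 2 ≤ C ^ 2 * ((p ⬝ᵥ p) * (q ⬝ᵥ q)) := by
    intro p q
    have h1 := Finset.sum_mul_sq_le_sq_mul_sq Finset.univ p (E *ᵥ q - EH *ᵥ q)
    have hp : 0 ≤ ∑ i, p i ^ 2 := Finset.sum_nonneg fun i _ => sq_nonneg _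
    rw [dotProduct, self_dotProduct_eq_sum_sq, self_dotProduct_eq_sum_sq]
    calc (∑ i, p i * (E *ᵥ q - EH *ᵥ q) i) ^ 2 ≤ (∑ i, p i ^ 2) * ∑ i, (E *ᵥ q - EH *ᵥ q) i ^ 2 := h1
      _ ≤ (∑ i, p i ^ 2) * (C ^ 2 * ∑ i, q i ^ 2) := mul_le_mul_of_nonneg_left (hdef q) hp
      _ = C ^ 2 * ((∑ i, p i ^ 2) * ∑ i, q i ^ 2) := by ring
  -- decompose the skew form
  have hdec : x ⬝ᵥ E *ᵥ z - z ⬝ᵥ E *ᵥ x = x ⬝ᵥ (E *ᵥ z - EH *ᵥ z) - z ⬝ᵥ (E *ᵥ x - EH *ᵥ x) := by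
    rw [dotProduct_sub, dotProduct_sub, hsym0]; ring
  rw [hdec]
  have hx0 : 0 ≤ x ⬝ᵥ x := by rw [self_dotProduct_eq_sum_sq]; exact Finset.sum_nonneg fun i _ => sq_nonneg _
  have hz0 : 0 ≤ z ⬝ᵥ z := by rw [self_dotProduct_eq_sum_sq]; exact Finset.sum_nonneg fun i _ => sq_nonneg _
  have h1 := hcs x z
  have h2 := hcs z x
  -- |a| ≤ C√(xx zz) ≤ C (xx+zz)/2 ; use squares: a ≤ C (xx + zz)/2 since a² ≤ C² xx zz ≤ (C (xx+zz)/2)²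
  have hb1 : x ⬝ᵥ (E *ᵥ z - EH *ᵥ z) ≤ C * ((x ⬝ᵥ x + z ⬝ᵥ z) / 2) := by
    have hsq : (x ⬝ᵥ (E *ᵥ z - EH *ᵥ z)) ^ 2 ≤ (C * ((x ⬝ᵥ x + z ⬝ᵥ z) / 2)) ^ 2 :=
      calc (x ⬝ᵥ (E *ᵥ z - EH *ᵥ z)) ^ 2 ≤ C ^ 2 * ((x ⬝ᵥ x) * (z ⬝ᵥ z)) := h1
        _ ≤ C ^ 2 * ((x ⬝ᵥ x + z ⬝ᵥ z) / 2) ^ 2 :=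
          mul_le_mul_of_nonneg_left (by nlinarith [sq_nonneg (x ⬝ᵥ x - z ⬝ᵥ z)]) (sq_nonneg C)
        _ = (C * ((x ⬝ᵥ x + z ⬝ᵥ z) / 2)) ^ 2 := by ring
    exact (abs_le_of_sq_le_sq' hsq (by positivity)).2
  have hb2 : -(C * ((x ⬝ᵥ x + z ⬝ᵥ z) / 2)) ≤ z ⬝ᵥ (E *ᵥ x - EH *ᵥ x) := by
    have hsq : (z ⬝ᵥ (E *ᵥ x - EH *ᵥ x)) ^ 2 ≤ (C * ((x ⬝ᵥ x + z ⬝ᵥ z) / 2)) ^ 2 :=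
      calc (z ⬝ᵥ (E *ᵥ x - EH *ᵥ x)) ^ 2 ≤ C ^ 2 * ((z ⬝ᵥ z) * (x ⬝ᵥ x)) := h2
        _ ≤ C ^ 2 * ((x ⬝ᵥ x + z ⬝ᵥ z) / 2) ^ 2 :=
          mul_le_mul_of_nonneg_left (by nlinarith [sq_nonneg (x ⬝ᵥ x - z ⬝ᵥ z)]) (sq_nonneg C)
        _ = (C * ((x ⬝ᵥ x + z ⬝ᵥ z) / 2)) ^ 2 := by ring
    exact (abs_le_of_sq_le_sq' hsq (by positivity)).1
  have hCC : C * ((x ⬝ᵥ x + z ⬝ᵥ z) / 2) + C * ((x ⬝ᵥ x + z ⬝ᵥ z) / 2) =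
      τ * hi * u * Real.exp (-(lo * u)) * ((x ⬝ᵥ x + z ⬝ᵥ z) / 2) := by rw [hC]; ring
  linarith

/-- **The skew part of the quasi-static response of a sectorial block** (`T ≥ 0`):
`xᵀf_T(B)z − zᵀf_T(B)x ≤ τ·hi·g_T(lo)·(|x|² + |z|²)/2`. [folklore] -/
theorem skewForm_qsResp_le {ρ T : ℝ} (hT : 0 ≤ T) {B : Matrix (Fin 3) (Fin 3) ℝ} {τ lo hi : ℝ} (hτ : 0 ≤ τ) (hlo : 0 < lo)
    (hsec : ∀ x z : Fin 3 → ℝ, (x ⬝ᵥ B *ᵥ z - z ⬝ᵥ B *ᵥ x) ^ 2 ≤ τ ^ 2 * ((x ⬝ᵥ B *ᵥ x) * (z ⬝ᵥ B *ᵥ z)))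
    (hwin : ∀ x : Fin 3 → ℝ, lo * (x ⬝ᵥ x) ≤ x ⬝ᵥ B *ᵥ x ∧ x ⬝ᵥ B *ᵥ x ≤ hi * (x ⬝ᵥ x)) (x z : Fin 3 → ℝ) :
    x ⬝ᵥ (qsResp ρ T B) *ᵥ z - z ⬝ᵥ (qsResp ρ T B) *ᵥ x ≤
      τ * hi * qsRespMoment ρ T lo * ((x ⬝ᵥ x + z ⬝ᵥ z) / 2) := by
  rw [skewForm_eq_sum_sum]
  set k := τ * hi * ((x ⬝ᵥ x + z ⬝ᵥ z) / 2) with hk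
  have hg : Continuous fun u : ℝ => k * (u * Real.exp (-u * lo)) := by fun_prop
  have hle : ∀ u : ℝ, 0 ≤ u → ∑ i, ∑ j, (x i * z j - z i * x j) * (NormedSpace.exp (-(u • B))) i j ≤
      k * (u * Real.exp (-u * lo)) := by
    intro u hu
    have h := skewForm_exp_le hτ hlo hsec hwin x z hu
    rw [skewForm_eq_sum_sum] at h
    have he : Real.exp (-u * lo) = Real.exp (-(lo * u)) := by congr 1; ring
    rw [he, hk]
    linarith
  have h := sum_sum_mul_qsResp_coeff_le (ρ := ρ) (B := B) hT (fun i j => x i * z j - z i * x j) hg hle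
  have hid : T * ∫ s in (0:ℝ)..1, LatticeShear.LatticeWord.trapezoid 0 1 ρ s *
      ∫ x in (0:ℝ)..s, LatticeShear.LatticeWord.trapezoid 0 1 ρ x *
        (k * ((T * (s - x)) * Real.exp (-(T * (s - x)) * lo))) = k * qsRespMoment ρ T lo :=
    kernel_moment_const_eq ρ T lo k
  have h' : ∑ i, ∑ j, (x i * z j - z i * x j) * qsResp ρ T B i j ≤ k * qsRespMoment ρ T lo := by
    rw [← hid]
    refine h.trans (le_of_eq ?_)
    congr 1
  calc ∑ i, ∑ j, (x i * z j - z i * x j) * qsResp ρ T B i j ≤ k * qsRespMoment ρ T lo := h'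
    _ = τ * hi * qsRespMoment ρ T lo * ((x ⬝ᵥ x + z ⬝ᵥ z) / 2) := by rw [hk]; ring

/-- **THE LOSSY SECTOR OF THE SLOT RESPONSE (a proved substitute for hypothesis L1⁺).**  For `T ≥ 0`, `B` sectorial (`τ ≥ 0`, window `[lo, hi]`,
`0 < lo`), with `ylo := f_T(hi) − (τhi/2)·g_T(lo) > 0`:  `(xᵀFz − zᵀFx)² ≤ (τ·θ)²·(xᵀFx)(zᵀFz)` for `F = f_T(B)` and
`θ = hi·g_T(lo)/ylo`.  (Scaling `x ↦ λx`, `z ↦ z/λ` turns the AM–GM form of `skewForm_qsResp_le` into the product form.)  Static limit `θ → ΛV⁴/(1 − τΛV⁴/2)`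
for the window `[1/ΛV, ΛV]`; admissible (`γ(c)·θ < 1`) for `ΛV ≤ 1.03` (table in the memo, §8). [folklore] -/
theorem qsResp_sector_lossy {ρ T : ℝ} (hT : 0 ≤ T) {B : Matrix (Fin 3) (Fin 3) ℝ} {τ lo hi : ℝ} (hτ : 0 ≤ τ) (hlo : 0 < lo)
    (hsec : ∀ x z : Fin 3 → ℝ, (x ⬝ᵥ B *ᵥ z - z ⬝ᵥ B *ᵥ x) ^ 2 ≤ τ ^ 2 * ((x ⬝ᵥ B *ᵥ x) * (z ⬝ᵥ B *ᵥ z)))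
    (hwin : ∀ x : Fin 3 → ℝ, lo * (x ⬝ᵥ x) ≤ x ⬝ᵥ B *ᵥ x ∧ x ⬝ᵥ B *ᵥ x ≤ hi * (x ⬝ᵥ x))
    (hylo : 0 < qsRespScalar ρ T hi - τ * hi / 2 * qsRespMoment ρ T lo) (x z : Fin 3 → ℝ) :
    (x ⬝ᵥ (qsResp ρ T B) *ᵥ z - z ⬝ᵥ (qsResp ρ T B) *ᵥ x) ^ 2 ≤
      (τ * (hi * qsRespMoment ρ T lo / (qsRespScalar ρ T hi - τ * hi / 2 * qsRespMoment ρ T lo))) ^ 2 *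
        ((x ⬝ᵥ (qsResp ρ T B) *ᵥ x) * (z ⬝ᵥ (qsResp ρ T B) *ᵥ z)) := by
  set F := qsResp ρ T B with hF
  set g := qsRespMoment ρ T lo with hg
  set ylo := qsRespScalar ρ T hi - τ * hi / 2 * qsRespMoment ρ T lo with hylo_def
  have hLE := lowerEdgeTarget_holds ρ T hT B τ lo hi hτ hlo hsec hwin
  have hx : ylo * (x ⬝ᵥ x) ≤ x ⬝ᵥ F *ᵥ x := hLE x
  have hz : ylo * (z ⬝ᵥ z) ≤ z ⬝ᵥ F *ᵥ z := hLE z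
  have hhi : 0 ≤ hi := hlo.le.trans (lo_le_hi_of_window hwin)
  have hx0 : 0 ≤ x ⬝ᵥ x := by rw [self_dotProduct_eq_sum_sq]; exact Finset.sum_nonneg fun i _ => sq_nonneg _
  have hz0 : 0 ≤ z ⬝ᵥ z := by rw [self_dotProduct_eq_sum_sq]; exact Finset.sum_nonneg fun i _ => sq_nonneg _
  -- g ≥ 0 (moment of a nonnegative kernel): from skewForm bound at x = z? use the AM-GM bound with (x, z) ↦ (x, x): 0 ≤ τ hi g |x|²... not needed;
  -- product form of the skew bound: for every t > 0, a ≤ τ hi g (t|x|² + |z|²/t)/2, hence a² ≤ (τ hi g)² |x|²|z|².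
  have hprod : (x ⬝ᵥ F *ᵥ z - z ⬝ᵥ F *ᵥ x) ^ 2 ≤ (τ * hi * g) ^ 2 * ((x ⬝ᵥ x) * (z ⬝ᵥ z)) := by
    -- scaling: apply the AM–GM bound to (c • x, z) and (x, c • z) for all c, read off the discriminant
    have key : ∀ c : ℝ, c * (x ⬝ᵥ F *ᵥ z - z ⬝ᵥ F *ᵥ x) ≤ τ * hi * g * ((c ^ 2 * (x ⬝ᵥ x) + z ⬝ᵥ z) / 2) := by
      intro c
      have h := skewForm_qsResp_le (ρ := ρ) hT hτ hlo hsec hwin (c • x) z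
      rw [hF.symm] at h
      have e1 : (c • x) ⬝ᵥ F *ᵥ z = c * (x ⬝ᵥ F *ᵥ z) := by rw [smul_dotProduct, smul_eq_mul]
      have e2 : z ⬝ᵥ F *ᵥ (c • x) = c * (z ⬝ᵥ F *ᵥ x) := by rw [Matrix.mulVec_smul, dotProduct_smul, smul_eq_mul]
      have e3 : (c • x) ⬝ᵥ (c • x) = c ^ 2 * (x ⬝ᵥ x) := by
        rw [smul_dotProduct, dotProduct_smul, smul_eq_mul, smul_eq_mul]; ring
      rw [e1, e2, e3] at h
      linarith
    -- quadratic in c nonneg for all c ⇒ discriminant ≤ 0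
    set a := x ⬝ᵥ F *ᵥ z - z ⬝ᵥ F *ᵥ x with ha
    set m := τ * hi * g with hm
    have hsum : 0 ≤ m * ((x ⬝ᵥ x + z ⬝ᵥ z) / 2) := by
      have h1 := key 1
      have h2 := key (-1)
      norm_num at h1 h2
      linarith
    -- For all c: (m xx/2) c² − a c + m zz/2 ≥ 0.
    by_cases hxx : x ⬝ᵥ x = 0
    · -- then a = 0: from key with c → ±large
      have h1 : ∀ c : ℝ, c * a ≤ m * (z ⬝ᵥ z) / 2 := by
        intro c; have h := key c; rw [hxx, mul_zero, zero_add] at h; linarith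
      have ha0 : a = 0 := by
        by_contra hne
        have hpos : 0 < a ^ 2 := by positivity
        have h3 := h1 ((m * (z ⬝ᵥ z) / 2 + 1) / a)
        rw [div_mul_cancel₀ _ hne] at h3
        linarith
      rw [ha0, hxx]; simp
    · have hxpos : 0 < x ⬝ᵥ x := lt_of_le_of_ne hx0 (Ne.symm hxx)
      by_cases hm' : m = 0
      · have h1 : ∀ c : ℝ, c * a ≤ 0 := by intro c; have := key c; rw [hm'] at this; simpa using this
        have ha0 : a = 0 := by
          have h2 := h1 a; have h3 := h1 (-a); nlinarith
        rw [ha0, hm']; simp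
      · have hmnn : 0 ≤ m := by
          by_contra hmn
          push Not at hmn
          have : m * ((x ⬝ᵥ x + z ⬝ᵥ z) / 2) < 0 := mul_neg_of_neg_of_pos hmn (by linarith)
          linarith
        have hmpos : 0 < m := lt_of_le_of_ne hmnn (Ne.symm hm')
        -- choose c = a / (m xx)
        have h := key (a / (m * (x ⬝ᵥ x)))
        have hmx : 0 < m * (x ⬝ᵥ x) := mul_pos hmpos hxpos
        have e : a / (m * (x ⬝ᵥ x)) * a = a ^ 2 / (m * (x ⬝ᵥ x)) := by rw [div_mul_eq_mul_div, sq]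
        rw [e] at h
        have e2 : (a / (m * (x ⬝ᵥ x))) ^ 2 * (x ⬝ᵥ x) = a ^ 2 / (m ^ 2 * (x ⬝ᵥ x)) := by
          field_simp
        rw [e2] at h
        -- h : a²/(m xx) ≤ m (a²/(m² xx) + zz)/2 = a²/(2 m xx) + m zz/2 ⇒ a²/(2 m xx) ≤ m zz/2 ⇒ a² ≤ m² xx zz
        have h3 : a ^ 2 / (m * (x ⬝ᵥ x)) ≤ m * (z ⬝ᵥ z) := by
          have : m * ((a ^ 2 / (m ^ 2 * (x ⬝ᵥ x)) + z ⬝ᵥ z) / 2) = a ^ 2 / (m * (x ⬝ᵥ x)) / 2 + m * (z ⬝ᵥ z) / 2 := by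
            field_simp
          rw [this] at h
          linarith
        rw [div_le_iff₀ hmx] at h3
        nlinarith
  -- convert |x|²|z|² into the forms via the lower window
  have hxF : x ⬝ᵥ x ≤ (x ⬝ᵥ F *ᵥ x) / ylo := by rw [le_div_iff₀ hylo]; linarith
  have hzF : z ⬝ᵥ z ≤ (z ⬝ᵥ F *ᵥ z) / ylo := by rw [le_div_iff₀ hylo]; linarith
  have hFx0 : 0 ≤ x ⬝ᵥ F *ᵥ x := le_trans (mul_nonneg hylo.le hx0) hx
  have hFz0 : 0 ≤ z ⬝ᵥ F *ᵥ z := le_trans (mul_nonneg hylo.le hz0) hz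
  calc (x ⬝ᵥ F *ᵥ z - z ⬝ᵥ F *ᵥ x) ^ 2 ≤ (τ * hi * g) ^ 2 * ((x ⬝ᵥ x) * (z ⬝ᵥ z)) := hprod
    _ ≤ (τ * hi * g) ^ 2 * (((x ⬝ᵥ F *ᵥ x) / ylo) * ((z ⬝ᵥ F *ᵥ z) / ylo)) :=
        mul_le_mul_of_nonneg_left (mul_le_mul hxF hzF hz0 (div_nonneg hFx0 hylo.le)) (sq_nonneg _)
    _ = (τ * (hi * g / ylo)) ^ 2 * ((x ⬝ᵥ F *ᵥ x) * (z ⬝ᵥ F *ᵥ z)) := by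
        field_simp

/-- **TYPED + PROVED: the lossy sector of the slot response** (substitute for hypothesis L1⁺ of p644915 / p650822 / §4: feed
`oddSectorial_excQS_strict_of_slotWindows` with `τ·θ` in place of `τ` — the sector inequality is congruence-invariant, so it transports to
`slotQ = m·PᵀF P`; the odd contraction becomes `κ = γ(c)·θ`). -/
def LossySectorTarget (ρ : ℝ) : Prop :=
  ∀ T : ℝ, 0 ≤ T → ∀ (B : Matrix (Fin 3) (Fin 3) ℝ) (τ lo hi : ℝ), 0 ≤ τ → 0 < lo →
    (∀ x z : Fin 3 → ℝ, (x ⬝ᵥ B *ᵥ z - z ⬝ᵥ B *ᵥ x) ^ 2 ≤ τ ^ 2 * ((x ⬝ᵥ B *ᵥ x) * (z ⬝ᵥ B *ᵥ z))) →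
    (∀ x : Fin 3 → ℝ, lo * (x ⬝ᵥ x) ≤ x ⬝ᵥ B *ᵥ x ∧ x ⬝ᵥ B *ᵥ x ≤ hi * (x ⬝ᵥ x)) →
    0 < qsRespScalar ρ T hi - τ * hi / 2 * qsRespMoment ρ T lo →
    ∀ x z : Fin 3 → ℝ,
      (x ⬝ᵥ (qsResp ρ T B) *ᵥ z - z ⬝ᵥ (qsResp ρ T B) *ᵥ x) ^ 2 ≤
        (τ * (hi * qsRespMoment ρ T lo / (qsRespScalar ρ T hi - τ * hi / 2 * qsRespMoment ρ T lo))) ^ 2 *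
          ((x ⬝ᵥ (qsResp ρ T B) *ᵥ x) * (z ⬝ᵥ (qsResp ρ T B) *ᵥ z))

/-- **PROVED.** -/
theorem lossySectorTarget_holds (ρ : ℝ) : LossySectorTarget ρ :=
  fun _ hT _ _ _ _ hτ hlo hsec hwin hylo x z => qsResp_sector_lossy (ρ := ρ) hT hτ hlo hsec hwin hylo x z

end LossySector

end Summit.AnomalousDissipation.AnomalousDissipation.Theorems.SolenoidalFractalHomogenisation.LagrangianStep.OddGain

end
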